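import Mathlib
import HarnessLib
import HarnessLib.Audit
import Summits.SmoothPoincare4.Statement
import Literature.Topology.FourManifolds.HomotopySpheres
import Literature.Topology.FourManifolds.ConnectedSum
import Literature.Topology.FourManifolds.SmoothOrientation
import Literature.Topology.FourManifolds.HomotopyS4CompactProofs
import Literature.Topology.FourManifolds.HomotopyS4OrientableProofs
import Literature.Topology.FourManifolds.CorkTwist
import Summits.SmoothPoincare4.SmoothPoincare4.Theorems.StabilisationAssembly
import Summits.SmoothPoincare4.SmoothPoincare4.Theorems.SullivanDualSpc4ReductionHomotopySphere
import HarnessLib.Audit.Status.Attr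

/-!
Route: Stabilisation

# Route Stabilisation — one S²×S² stabilisation, then one-summand cancellation (SmoothPoincare4,
positive side)

It suffices to show X = S1 ∧ S2. (S1) ONE STABILISATION SUFFICES: for every homotopy 4-sphere Σ (a
`Literature.Topology.FourManifolds.HomotopySphere 4`: closed, oriented, smooth, ≃ₕ S⁴) some
connected sum Σ # (S²×S²) — relational `Literature.Topology.FourManifolds.IsConnectedSum`, the sum
modelled on 𝓡 4, S²×S² on the product model (𝓡 2).prod (𝓡 2) — is diffeomorphic to S²×S². (S2)
ONE-SUMMAND CANCELLATION: every homotopy 4-sphere admitting such a stabilisation is diffeomorphic to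
S⁴. S1 = item StabOneSuffices (crux, rank 3), S2 = item StabCancellation (crux, rank 2), X = item
StabThesis (target, rank 0). SPC4 ⇒ S1 and S2 (S⁴ # Q ≅ Q), so X ⇔ SPC4; the content of the line is
the SPLIT into "k = 1 in Wall's theorem" and "cancellation of one S²×S² summand at b₂ = 0".
Lean: StabOneSuffices ∧ StabCancellation
where, with Q := Metric.sphere (0 : EuclideanSpace ℝ (Fin 3)) 1 × Metric.sphere (0 : EuclideanSpace
ℝ (Fin 3)) 1 and OneStab S := ∃ (P : Type) (_ : TopologicalSpace P) (_ : ChartedSpace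
(EuclideanSpace ℝ (Fin 4)) P) (_ : IsManifold (𝓡 4) ∞ P),
Literature.Topology.FourManifolds.IsConnectedSum (𝓡 4) (𝓡 4) ((𝓡 2).prod (𝓡 2)) S.carrier Q P ∧
Nonempty (P ≃ₘ⟮𝓡 4, (𝓡 2).prod (𝓡 2)⟯ Q): StabOneSuffices := ∀ S :
Literature.Topology.FourManifolds.HomotopySphere 4, OneStab S and StabCancellation := ∀ S :
Literature.Topology.FourManifolds.HomotopySphere 4, OneStab S → Nonempty (S.carrier ≃ₘ⟮𝓡 4, 𝓡 4⟯
Metric.sphere (0 : EuclideanSpace ℝ (Fin 5)) 1) (both spelled out in the items; `open scoped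
Manifold ContDiff`).

## Assembly
Deciding theorem (PROVED, planner glue 2026-08-15): `closes : StabCancellation → StabOneSuffices →
SmoothPoincare4`. Given M (Hausdorff, second countable, C^∞ on 𝓡 4) and e : M ≃ₕ S⁴, M is compact by
the tree theorem `Literature.Topology.FourManifolds.compactSpace_of_homotopyEquiv_sphere_four_holds`
(HatcherAT2002 Prop 3.29 + Cor 2.14, proved in tree) and orientable by
`Literature.Topology.FourManifolds.isOrientable_of_homotopyEquiv_sphere_four_holds`
(LeeSmoothManifolds2013 Thm 15.43, proved in tree), so (M, a chosen orientation, e) packages as S :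
HomotopySphere 4 and S2 S (S1 S) is the required diffeomorphism M ≃ₘ S⁴. The item `Assembly` ((S1 ∧
S2) → SmoothPoincare4, stmt-SmoothPoincare4-0398) is the same argument and is provable now; the
shared reductions Spc4ReductionHomotopySphere (0374) / …V2 (0441, proved in
Theorems/PICReduction.lean) are kept as support for the six sibling routes that want them.

Rationale: WHY THIS LINE. Wall's theorem (WallJLMS1964 Thm 3; Kirby1989 Ch. X Thm 3: closed smooth 1-connected
4-manifolds with isomorphic forms become diffeomorphic after # k(S²×S²)) together with Θ₄ = 0 in the
h-cobordism sense (KervaireMilnorAnnals1963 Thm 1.1 / WallJLMS1964 Thm 2: every homotopy 4-sphere Σ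
is h-cobordant to S⁴) gives Σ # k(S²×S²) ≅ # k(S²×S²) for SOME k; the line bets k = 1 (S1) and
isolates the genuinely four-dimensional step as the cancellation of a single S²×S² summand at b₂ = 0
(S2), which is exactly the setting — a transverse pair of square-0 spheres (A, G) in S²×S² with A·G
= 1 and simply connected complement, whose surgery is Σ — where the isotopy technology for spheres
with geometric duals applies (Gabai2020 light-bulb theorem, arXiv:1705.09989 Thm 1.2;
Schneiderman–Teichner). Imported from another area: surgery / stable classification (Wall, Kreck)
for S1 and light-bulb isotopy for S2; none of the analytic reformulations. Evidence for k = 1: every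
Gluck twist dissolves after one ℂP² summand (GompfStipsicz1999 Ex. 5.2.7(b), quoted in
KasprowskiPowellRay2023 = arXiv:2206.14113 p.6) and the standardised Cappell–Shaneson spheres were
shown standard by explicit one-pair handle cancellation (GompfAGT2010, Akbulut2010); no homotopy
4-sphere is known to need k ≥ 2. Against: one S²×S² is NOT enough for contractible pieces
(Kang2022OneStabilization Thm 1.1, arXiv:2210.07510) and 1-stably diffeomorphic exotic CLOSED pairs
exist at b₂ > 0 (Baykur–Sunukjian arXiv:1009.0514 Cor. 16), so both cruxes escape the catalogued
barriers by scope only (closed, b₂ = 0 — Kang's open Question 1). Route repair 2026-08-15: the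
deciding theorem `closes : StabCancellation → StabOneSuffices → SmoothPoincare4` is proved
(packaging of M ≃ₕ S⁴ as a HomotopySphere 4 via the tree theorems
compactSpace_of_homotopyEquiv_sphere_four_holds / isOrientable_of_homotopyEquiv_sphere_four_holds).
ROUTE-CHOICE VERDICT 2026-08-15 (planner-rchoice unit, on the XL fact
Literature.Topology.FourManifolds.corkDecomposition): RE-ROUTE, not promote. corkDecomposition
enters the cone ONLY as hypothesis hD of the cork-branch glue Assembly3 (stmt-0479; gate deps:
n_unproved = 1, via Assembly3 only); `closes` never uses it, so it is not load-bearing, and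
promoting it to a crux would seat provers on formalising Matveyev/CFHS 1996 (a known theorem, XL)
for a branch that is an alternative decomposition of the same target (D-0019 ⇒ a sibling cork
route). The re-route = dropping the parked cork branch — StabCorkTwistSphere (stmt-0478, support, ⇔
SPC4), its glue Assembly3 (0479) and the superseded glue Assembly2 (0449), all wanted by no other
route — is an OPERATOR ACTION, verified again 2026-08-15T17Z: `--drop Assembly3` → "the assembly
item cannot be dropped"; `--retriage` 0449/0479 → "the assembly item cannot be retriaged";
`--restate Assembly3` (curried closes-type, Sketch rc 0) → bounced by the D-0019 post-check
route.multi-assembly (3 assembly items), which no planner verb can reduce. Command: `ledger route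
edit route-SmoothPoincare4-Stabilisation --drop Assembly2 --drop Assembly3 --drop
StabCorkTwistSphere --note "route-choice: re-route, cork branch out"` (optionally prune import
Literature.Topology.FourManifolds.CorkTwist). Pre-checked result: the remaining file (StabThesis,
StabCancellation, StabOneSuffices, Spc4ReductionHomotopySphere, …V2, Assembly + closes) elaborates
without the CorkTwist import (lean check rc 0, closes[route]: OK, axioms
propext/Classical.choice/Quot.sound), its cone is definitions only (IsConnectedSum, IsOpenGluing,
connectedSumRel, puncture, HomotopySphere, SmoothOrientation, IsOrientable) and the route is
staffable with exactly one assembly (Assembly, stmt-0398). needs-fact: NONE.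

RANKED CRUXES. #2 StabCancellation (crux) — one-summand cancellation: ∀ Σ : HomotopySphere 4, (∃ P,
IsConnectedSum Σ (S²×S²) P ∧ P ≃ₘ S²×S²) → Σ ≃ₘ S⁴; = SPC4 restricted to 1-stably-standard homotopy
spheres (why it might fail: Gabai's LBT standardises the sphere A only when its dual G is already a
standard factor, so a jointly knotted dual pair (A, G) ⊂ S²×S² with fake-4-ball complement refutes
it, and no 4-d one-summand cancellation theorem exists — false at b₂ > 0; sources: Gabai2020 Thm
1.2/1.9, FreedmanGompfMorrisonWalker2010 §3 p.10, WallJLMS1964 Thm 3, arXiv:1009.0514 Cor. 16,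
Matveyev1996, CurtisFreedmanHsiangStong1996). #3 StabOneSuffices (crux) — one stabilisation
suffices: ∀ Σ : HomotopySphere 4, ∃ P, IsConnectedSum Σ (S²×S²) P ∧ P ≃ₘ S²×S² (why it might fail:
Wall gives SOME k; k = 1 is Stern's Problem 14 on homotopy spheres, open even for Gluck twists of
non-ribbon 2-knots where only ℂP²/ℂP²bar dissolution is printed (AkbulutYasui2013 needs an odd
class); one S²×S² does not undo every cork (Kang2022OneStabilization Thm 1.1 / Cor 1.2), so an
exotic Σ needing k ≥ 2 kills S1; sources: WallJLMS1964 Thm 3, Kang2022OneStabilization,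
KasprowskiPowellRay2023 Lemma 3.1, AkbulutYasui2013 Thm 1.1, arXiv:1009.0514 p.3,
Literature.Barriers.SmoothPoincare4.OneStabilisationBarrier). Target #0 StabThesis = S1 ∧ S2.
Support (rank 5, shared with six sibling routes, closable now): Spc4ReductionHomotopySphere (0374),
Spc4ReductionHomotopySphereV2 (0441, proved in Theorems/PICReduction.lean). Assembly #1 (0398): (S1
∧ S2) → SmoothPoincare4, provable now by the proof of `closes`.

KILL CRITERIA. A refutation of S1 (a homotopy 4-sphere Σ with Σ # (S²×S²) ≇ S²×S²) or of S2 (a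
1-stably-standard Σ ≇ S⁴) exhibits an exotic S⁴, i.e. refutes SmoothPoincare4 itself: the route then
closes `refuted` together with the positive side of the problem and its witness is handed to the
negative side. Soft kill (close as superseded, merge into route NoOneHandles): a cheap proof that S1
alone is EQUIVALENT to SPC4 (the split is then illusory), e.g. if every h-cobordism S⁴ ~ Σ could be
taken with one 2- /3-handle pair for free. Pivot trigger (not a kill): S1 settled on all Gluck twists
but S2 stuck ⇒ open the ℂP² sibling (below) rather than deepen here.

NOT DECOMPOSED YET. (a) The cork branch — "every cork twist of S⁴ along a compact contractible C is
S⁴" (item StabCorkTwistSphere, support since 2026-08-15, ⇔ SPC4; Gompf arXiv:1603.05090 Question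
2.2) with glue corkDecomposition → Θ₄-hcob → cork statement → ∀ Σ ≅ S⁴ (item Assembly3, proved in
tree as Literature.SPC4.stab_cork_assembly): an ALTERNATIVE decomposition of the same target, hence
a route of its own (D-0019), whose own items must carry
Literature.Topology.FourManifolds.corkDecomposition (Matveyev1996 / CurtisFreedmanHsiangStong1996;
unproved, XL) and the Θ₄ h-cobordism fact as tier-0 debt — parked here as support pending the
operator drop, to be re-wanted by that route; it is NOT on the line `closes` uses and no prover
should be seated on it from this route. (b) The ℂP² branch — StabOneCP2: ∀ Σ, Σ # ℂP² ≅ ℂP² (KNOWN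
for all Gluck twists, GompfStipsicz1999 Ex. 5.2.7(b)) and StabCP2Cancellation: Σ # ℂP² ≅ ℂP² ⇒ Σ ≅
S⁴, over Literature.Topology.FourManifolds.ComplexProjectivePlane: also a sibling route, prepared
but not applied by planner-SmoothPoincare4-route-SmoothPoincare4-Stabilisation-0 (2026-08-15 10:57Z;
files lost with that box). (c) Glued split of S2 once S1 closes on a family (see TWO-LAYER PLAN).
(d) The value of k in Wall's theorem for named families (upper bound = number of 2-handles of an
h-cobordism to S⁴).

CHEAPEST FALSIFIER. Lookup first, then one computation: (i) is "Σ_K # (S²×S²) ≅ S²×S² for every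
Gluck twist Σ_K" already in print (GompfStipsicz1999 §6.2 / Ex. 5.2.7(b) context; grounder-B
2026-08-13 left this unresolved — only the ℂP² and ℂP²bar summands are certainly printed)? If some
Gluck twist or some Kang-type example (a homotopy sphere containing the cork of
Kang2022OneStabilization Thm 1.1 so that the one-stabilisation obstruction survives closing up) is
known NOT to dissolve after one S²×S², S1 is dead and the line with it; (ii) otherwise the refuter's
cheapest concrete attack is a Kirby-calculus certificate that the Gluck twist of the 2-twist-spun
trefoil # (S²×S²) is S²×S² (expected: yes, by the slides of GompfStipsicz1999 Ex. 5.2.7(b) with the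
even summand) — a "no" cannot be certified by calculus, so beyond (i)–(ii) every falsifier is an
exotic S⁴ and SPC4-hard.

TWO-LAYER PLAN. Foreseen glued split of StabCancellation (k = 2 ≤ 3, depth 1), to be filed only
after StabOneSuffices closes on a test family: C₁ (crux) — for every diffeomorphism φ : Σ # (S²×S²)
→ S²×S² the image pair (A, G) = φ(S²×pt, pt×S²) can be re-chosen (changing φ) with G = pt × S²
standard (why it might fail: jointly knotted dual pairs; this is where an exotic Σ would hide); C₂
(support, known) — a square-0 sphere A ⊂ S²×S² with the standard geometric dual pt × S² is isotopic
to S² × pt (Hurewicz: homologous ⇒ homotopic in the 1-connected S²×S²; Gabai2020 Thm 1.2, no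
2-torsion in π₁ = 1), hence surgery on A returns S⁴ and Σ ≅ S⁴; glue C₁ → C₂ → StabCancellation.

SUPPORT. Assembly (0398) and Spc4ReductionHomotopySphere (0374) are provable now with the same five
lines as `closes` (intro M … e; haveI := compactSpace_of_homotopyEquiv_sphere_four_holds M e; S :=
⟨M, Classical.choice (isOrientable_of_homotopyEquiv_sphere_four_holds M e), ⟨e⟩⟩; apply the
hypothesis); Spc4ReductionHomotopySphereV2 (0441) is
Literature.SPC4.smoothPoincare4_of_forall_homotopySphere (Theorems/PICReduction.lean). Idle provers
may close them; they do not drive staffing.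

SOURCES. WallJLMS1964; KervaireMilnorAnnals1963; Kirby1989; Gabai2020 (arXiv:1705.09989);
FreedmanGompfMorrisonWalker2010; GompfStipsicz1999; KasprowskiPowellRay2023 (arXiv:2206.14113);
GompfAGT2010; Akbulut2010; Kang2022OneStabilization (arXiv:2210.07510); AkbulutYasui2013;
arXiv:1009.0514 (Baykur–Sunukjian); Matveyev1996; CurtisFreedmanHsiangStong1996; arXiv:1603.05090
(Gompf); HatcherAT2002 Prop 3.29; LeeSmoothManifolds2013 Thm 15.43; Kirby1997 Problem 4.89.

Novelty: Prior art searched (survey planner 2026-08-13: lit frontier SmoothPoincare4; lit search/vsearch; lit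
read of every source below; repair planner 2026-08-15: lean search of the tree for the packaging
theorems and the cork fact, lit search arXiv:1009.0514): (i) WallJLMS1964 Thm 3 with
KervaireMilnorAnnals1963 Thm 1.1 gives Σ # k(S²×S²) ≅ # k(S²×S²); whether k = 1 suffices for
homeomorphic simply connected pairs is Stern's Problem 14 (recalled in Baykur–Sunukjian
arXiv:1009.0514 p.3) — negative for corks / contractible pieces (Kang2022OneStabilization Thm 1.1),
open for closed manifolds; S1 is that question on homotopy spheres. (ii)
FreedmanGompfMorrisonWalker2010 §3 p.10 already isolate "for homology 4-spheres stable
diffeomorphism implies diffeomorphism" ("probably dubious", "little progress"); S2 is its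
one-summand b₂ = 0 case, with Gabai2020 (light bulb, arXiv:1705.09989 Thm 1.2/1.9) the named tool
and KasprowskiPowellRay2023 the nearest recent use of one-stabilisation arguments on Gluck twists.
(iii) The cork reading (CurtisFreedmanHsiangStong1996, Matveyev1996, KirbyCorks1996; Gompf
arXiv:1603.05090 Question 2.2) is item StabCorkTwistSphere — support since 2026-08-15, off the line
`closes` uses, to move to a sibling cork route. Delta: no new mechanism — a typed restatement of
(i)–(ii) over the tree's relational IsConnectedSum; the structural content is the split SPC4 ⇔ (k =
1) ∧ (one-summand cancellation) into two separately staffable items, the reading of S2 as "the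
closed  [refs: 1009.0514, 1705.09989, 1603.05090, WallJLMS1964, KervaireMilnorAnnals1963, FreedmanGompfMorrisonWalker2010, Gabai2020, KasprowskiPowellRay2023, CurtisFreedmanHsiangStong1996, Matveyev1996, KirbyCorks1996]

Barriers (technique_class: h-cobordism; one-stabilisation; S2xS2-cancellation): - technique_class: h-cobordism; one-stabilisation; S2xS2-cancellation
- Literature.Barriers.SmoothPoincare4.OneStabilisationBarrier: (Kang2022OneStabilization: a cork /
contractible piece survives one S²×S²) hits S1 — cork-level one-stabilisation lemmas are dead; S1
escapes by scope only (closed, b₂ = 0 = Kang's open Question 1); the bet is that homotopy spheres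
are more rigid than contractible pieces.
- Literature.Barriers.SmoothPoincare4.HCobordismBarrierFour: (Donaldson: smooth h-cobordisms need
not be products) the general h-cobordism principle is not invoked, but S2 is its one-2/3-handle-pair
case, false at b₂ > 0 (1-stably diffeomorphic exotic pairs, arXiv:1009.0514 Cor. 16); evaded only by
b₂ = 0, where it is SPC4-hard; the bet is that a geometric dual pair in S²×S² (Gabai2020 setting) is
rigid.
- Literature.Barriers.SmoothPoincare4.GluckTwistCP2Barrier: only ℂP²/ℂP²bar-dissolution of Gluck
twists is certainly printed (AkbulutYasui2013 needs an odd class), so S1 is open already on Gluck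
twists of non-ribbon 2-knots — the intended first test family, not an obstruction.
- Literature.Barriers.SmoothPoincare4.StableBarrierFour and
Literature.Barriers.SmoothPoincare4.HCobordismInvariantBarrierFour: negative side — refuting either
crux needs an exotic S⁴, invisible to stable / h-cobordism invariants (semisimple or unitary TQFT,
SW/Donaldson vanish on homotopy spheres); a refuter must use an unstable invariant or a direct
non-dissolution certificate.
- Literature.Barriers.Smo

History (route lifecycle, newest last):
- 2026-08-16T14:43:06Z · LINT AUTOFIX route.multi-assembly: kept Assembly, dropped Assembly2, Assembly3 (gate:hygiene)
- 2026-08-23T11:39:05Z · DORMANT — reconciler: no traction for 6.1 d (last activity statement-grounded at 2026-08-17T08:43:30Z); parked, not closed — `ledger route dormant route-SmoothPoincare4-S (operator:999:430204)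
- 2026-08-30T05:45:43Z · REACTIVATED — reconciler: reactivated — activity item-evidence-added at 2026-08-30T04:40:16Z after parking at 2026-08-23T11:39:05Z (operator:999:1233677)

sub-problem: SmoothPoincare4 · status: open · opened planner-SmoothPoincare4-Survey-0 2026-08-13T06:11:42Z · rev 8 · ledger route-SmoothPoincare4-Stabilisation
GENERATED by the gate from the ledger (D-0016/17). Provers cite these decls: `theorem foo : Summit.SmoothPoincare4.SmoothPoincare4.Theses.Stabilisation.<Decl> := …` in Summits/SmoothPoincare4/SmoothPoincare4/Theorems/<Name>.lean.
-/

namespace Summit.SmoothPoincare4.SmoothPoincare4.Theses.Stabilisation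

open scoped BigOperators Topology Manifold Classical MeasureTheory ProbabilityTheory Matrix InnerProductSpace ComplexConjugate ContinuousMap ContDiff
open Filter Set Function TopologicalSpace MeasureTheory

attribute [summit_statement] _root_.SmoothPoincare4

open Literature.SPC4

/-! Retired items kept as plain definitions (history; not obligations of this route): landed proofs / closed glue still name them. -/

/-- retired stmt-SmoothPoincare4-0449 (dropped, gen None) — proved by Literature.SPC4.stab_assembly. -/
def Assembly2 : Prop :=
  (∀ (M : Type) [TopologicalSpace M] [T2Space M] [SecondCountableTopology M] [ChartedSpace (EuclideanSpace ℝ (Fin 4)) M] [IsManifold (𝓡 4) ∞ M], M ≃ₕ Metric.sphere (0 : EuclideanSpace ℝ (Fin 5)) 1 → CompactSpace M) → (∀ (M : Type) [TopologicalSpace M] [T2Space M] [SecondCountableTopology M] [ChartedSpace (EuclideanSpace ℝ (Fin 4)) M] [IsManifold (𝓡 4) ∞ M], M ≃ₕ Metric.sphere (0 : EuclideanSpace ℝ (Fin 5)) 1 → Literature.Topology.FourManifolds.IsOrientable (𝓡 4) M) → ((∀ S : Literature.Topology.FourManifolds.HomotopySphere 4, ∃ (P : Type) (_ : TopologicalSpace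 P) (_ : ChartedSpace (EuclideanSpace ℝ (Fin 4)) P) (_ : IsManifold (𝓡 4) ∞ P), Literature.Topology.FourManifolds.IsConnectedSum (𝓡 4) (𝓡 4) ((𝓡 2).prod (𝓡 2)) S.carrier (Metric.sphere (0 : EuclideanSpace ℝ (Fin 3)) 1 × Metric.sphere (0 : EuclideanSpace ℝ (Fin 3)) 1) P ∧ Nonempty (P ≃ₘ⟮𝓡 4, (𝓡 2).prod (𝓡 2)⟯ (Metric.sphere (0 : EuclideanSpace ℝ (Fin 3)) 1 × Metric.sphere (0 : EuclideanSpace ℝ (Fin 3)) 1))) ∧ (∀ S : Literature.Topology.FourManifolds.HomotopySphere 4, (∃ (P : Type) (_ : TopologicalSpace P) (_ : ChartedSpace (EuclideanSpace ℝ (Fin 4)) P) (_ : IsManifold (𝓡 4) ∞ P), Literature.Topology.FourManifolds.IsConnectedSum (𝓡 4) (𝓡 4) ((𝓡 2).prod (𝓡 2)) S.carrier (Metric.sphere (0 : EuclideanSpace ℝ (Fin 3)) 1 × Metric.sphere (0 : EuclideanSpace ℝ (Fin 3)) 1) P ∧ Nonempty (P ≃ₘ⟮𝓡 4, (𝓡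 2).prod (𝓡 2)⟯ (Metric.sphere (0 : EuclideanSpace ℝ (Fin 3)) 1 × Metric.sphere (0 : EuclideanSpace ℝ (Fin 3)) 1))) → Nonempty (S.carrier ≃ₘ⟮𝓡 4, 𝓡 4⟯ Metric.sphere (0 : EuclideanSpace ℝ (Fin 5)) 1))) → SmoothPoincare4

/-- retired stmt-SmoothPoincare4-0479 (dropped, gen None) — proved by Literature.SPC4.stab_cork_assembly. -/
def Assembly3 : Prop :=
  Literature.Topology.FourManifolds.corkDecomposition.{0} → (∀ S : Literature.Topology.FourManifolds.HomotopySphere 4, Literature.Topology.FourManifolds.IsHCobordant 4 S.carrier (Metric.sphere (0 : EuclideanSpace ℝ (Fin 5)) 1)) → (∀ (M : Type) [TopologicalSpace M], M ≃ₕ Metric.sphere (0 : EuclideanSpace ℝ (Fin 5)) 1 → SimplyConnectedSpace M) → (∀ (C : Type) [TopologicalSpace C] [T2Space C] [SecondCountableTopology C] [ChartedSpace (EuclideanHalfSpace 4) C] [IsManifold (𝓡∂ 4) ∞ C] [CompactSpace C] [ContractibleSpace C] (bC : Literature.Topology.FourManifolds.BoundaryData (𝓡∂ 4) C (𝓡 3))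 (τ : bC.carrier ≃ₘ⟮𝓡 3, 𝓡 3⟯ bC.carrier) (X : Type) [TopologicalSpace X] [T2Space X] [SecondCountableTopology X] [ChartedSpace (EuclideanSpace ℝ (Fin 4)) X] [IsManifold (𝓡 4) ∞ X], Literature.Topology.FourManifolds.IsCorkTwist bC τ (𝓡 4) (Metric.sphere (0 : EuclideanSpace ℝ (Fin 5)) 1) (𝓡 4) X → Nonempty (X ≃ₘ⟮𝓡 4, 𝓡 4⟯ Metric.sphere (0 : EuclideanSpace ℝ (Fin 5)) 1)) → ∀ S : Literature.Topology.FourManifolds.HomotopySphere 4, Nonempty (S.carrier ≃ₘ⟮𝓡 4, 𝓡 4⟯ Metric.sphere (0 : EuclideanSpace ℝ (Fin 5)) 1)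

/-- item stmt-SmoothPoincare4-0397 · target · rank 0 · open · by planner
why it might fail: X = S1 ∧ S2 ⇔ SPC4: false iff an exotic S⁴ exists — undecided candidate families remain (Gluck twists of non-ribbon 2-knots, Cappell–Shaneson matrices outside Gompf's classes).
sources: Kirby1997, Problem 4.89, FreedmanGompfMorrisonWalker2010, §2, WallJLMS1964, Thm. 3
(S1) ∀ homotopy 4-sphere Σ, some connected sum Σ # (S²×S²) (relational
`Literature.Topology.FourManifolds.IsConnectedSum`, sum modelled on 𝓡 4) is diffeomorphic to S²×S²
(product model (𝓡 2).prod (𝓡 2)); (S2) if so then Σ ≅ S⁴. Both follow from SPC4. Sources: Wall1964;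
KervaireMilnor1963; CurtisFreedmanHsiangStong1996; Matveyev1996; Gompf2010; Akbulut2010. opens:
`open scoped Manifold ContDiff`, `open ContinuousMap`; imports: Summits.SmoothPoincare4.Statement +
Literature.Topology.FourManifolds.{HomotopySpheres,KirbyMoves,SliceRibbon,LeeRasmussen,Morse,ConnectedSum,Cobordism,GluckTwist,SurgeryGluck,CappellShaneson}
+ Literature.Geometry.Lorentzian.LeviCivita. -/
@[route_item "route-SmoothPoincare4-Stabilisation"]
def StabThesis : Prop :=
  (∀ S : Literature.Topology.FourManifolds.HomotopySphere 4, ∃ (P : Type) (_ : TopologicalSpace P) (_ : ChartedSpace (EuclideanSpace ℝ (Fin 4)) P) (_ : IsManifold (𝓡 4) ∞ P), Literature.Topology.FourManifolds.IsConnectedSum (𝓡 4) (𝓡 4) ((𝓡 2).prod (𝓡 2)) S.carrier ((Metric.sphere (0 : EuclideanSpace ℝ (Fin 3)) 1) × (Metric.sphere (0 : EuclideanSpace ℝ (Fin 3)) 1)) P ∧ Nonempty (P ≃ₘ⟮𝓡 4, (𝓡 2).prod (𝓡 2)⟯ ((Metric.sphere (0 : EuclideanSpace ℝ (Fin 3))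 1) × (Metric.sphere (0 : EuclideanSpace ℝ (Fin 3)) 1)))) ∧ (∀ S : Literature.Topology.FourManifolds.HomotopySphere 4, (∃ (P : Type) (_ : TopologicalSpace P) (_ : ChartedSpace (EuclideanSpace ℝ (Fin 4)) P) (_ : IsManifold (𝓡 4) ∞ P), Literature.Topology.FourManifolds.IsConnectedSum (𝓡 4) (𝓡 4) ((𝓡 2).prod (𝓡 2)) S.carrier ((Metric.sphere (0 : EuclideanSpace ℝ (Fin 3)) 1) × (Metric.sphere (0 : EuclideanSpace ℝ (Fin 3)) 1)) P ∧ Nonempty (P ≃ₘ⟮𝓡 4, (𝓡 2).prod (𝓡 2)⟯ ((Metric.sphere (0 : EuclideanSpace ℝ (Fin 3)) 1) × (Metric.sphere (0 : EuclideanSpace ℝ (Fin 3)) 1)))) → Nonempty (S.carrier ≃ₘ⟮𝓡 4, 𝓡 4⟯ Metric.sphere (0 : EuclideanSpace ℝ (Fin 5)) 1))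

/-- item stmt-SmoothPoincare4-0385 · crux · rank 2 · open · by planner
why it might fail: = SPC4 on 1-stably-standard Σ: Gabai's LBT standardises A only if its dual G is a standard factor, so a jointly knotted dual pair (A, G) ⊂ S²×S² with fake-4-ball complement refutes it; no 4-d one-summand cancellation theorem exists (false at b₂>0, arXiv:1009.0514 Cor. 16).
sources: Gabai2020, Thm. 1.2 and Thm. 1.9 (arXiv:1705.09989), FreedmanGompfMorrisonWalker2010, §3 p.10, WallJLMS1964, Thm. 3, arXiv:1009.0514, Cor. 16, Matveyev1996, Theorem, CurtisFreedmanHsiangStong1996, Theorem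
SPC4 for 1-stably-standard homotopy spheres. Equivalent picture: an h-cobordism S⁴ → Σ with a single
2- /3-handle pair; or an embedded sphere in S²×S² with geometric dual and π₁-trivial complement whose
surgery is Σ. Tools: light-bulb theorems (Gabai2020; Schneiderman–Teichner), cork twists with one
2-handle pair (CurtisFreedmanHsiangStong1996, Matveyev1996). Sources: Wall1964;
CurtisFreedmanHsiangStong1996; Matveyev1996; Kirby1997 4. -/
@[route_item "route-SmoothPoincare4-Stabilisation", crux]
def StabCancellation : Prop :=
  ∀ S : Literature.Topology.FourManifolds.HomotopySphere 4, (∃ (P : Type) (_ : TopologicalSpace P) (_ : ChartedSpace (EuclideanSpace ℝ (Fin 4)) P) (_ : IsManifold (𝓡 4) ∞ P), Literature.Topology.FourManifolds.IsConnectedSum (𝓡 4) (𝓡 4) ((𝓡 2).prod (𝓡 2)) S.carrier ((Metric.sphere (0 : EuclideanSpace ℝ (Fin 3)) 1) × (Metric.sphere (0 : EuclideanSpace ℝ (Fin 3)) 1)) P ∧ Nonempty (P ≃ₘ⟮𝓡 4, (𝓡 2).prod (𝓡 2)⟯ ((Metric.sphere (0 : EuclideanSpace ℝ (Fin 3)) 1)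 × (Metric.sphere (0 : EuclideanSpace ℝ (Fin 3)) 1)))) → Nonempty (S.carrier ≃ₘ⟮𝓡 4, 𝓡 4⟯ Metric.sphere (0 : EuclideanSpace ℝ (Fin 5)) 1)

/-- item stmt-SmoothPoincare4-0386 · crux · rank 3 · open · by planner
why it might fail: Wall gives SOME k; k=1 is Stern's Problem 14 on homotopy spheres, open even for Gluck twists of non-ribbon 2-knots (only ℂP²/ℂP²bar dissolution printed; AkbulutYasui2013 needs an odd class); one S²×S² does NOT undo every cork (Kang2022 Thm 1.1), so an exotic Σ needing k ≥ 2 kills S1.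
sources: WallJLMS1964, Thm. 3, Kang2022OneStabilization, Thm. 1.1, Cor. 1.2, Question 1, KasprowskiPowellRay2023, Lemma 3.1, AkbulutYasui2013, Thm. 1.1 and Remark 1.2, arXiv:1009.0514, p.3 (Stern Problem 14), Literature.Barriers.SmoothPoincare4.OneStabilisationBarrier
Wall1964 + KervaireMilnor1963 (Σ h-cobordant to S⁴, cite item) give Σ #k(S²×S²) ≅ #k(S²×S²) for SOME
k; crux: k = 1. Known: Σ_K # ℂP² ≅ ℂP² for all Gluck twists (Gluck1962; GompfStipsicz1999 §6.2).
Sources: Wall1964; Gluck1962; GompfStipsicz1999 §6.2, §9. -/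
@[route_item "route-SmoothPoincare4-Stabilisation", crux]
def StabOneSuffices : Prop :=
  ∀ S : Literature.Topology.FourManifolds.HomotopySphere 4, ∃ (P : Type) (_ : TopologicalSpace P) (_ : ChartedSpace (EuclideanSpace ℝ (Fin 4)) P) (_ : IsManifold (𝓡 4) ∞ P), Literature.Topology.FourManifolds.IsConnectedSum (𝓡 4) (𝓡 4) ((𝓡 2).prod (𝓡 2)) S.carrier ((Metric.sphere (0 : EuclideanSpace ℝ (Fin 3)) 1) × (Metric.sphere (0 : EuclideanSpace ℝ (Fin 3)) 1)) P ∧ Nonempty (P ≃ₘ⟮𝓡 4, (𝓡 2).prod (𝓡 2)⟯ ((Metric.sphere (0 : EuclideanSpace ℝ (Fin 3)) 1) × (Metric.sphere (0 : EuclideanSpace ℝ (Fin 3)) 1)))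

/-- item stmt-SmoothPoincare4-0478 · support · rank 4 · open · by planner
why it might fail: ⇔ SPC4 (X is a homotopy sphere; ⇒ = proved Assembly3). Open concretely: Gompf's infinite-order corks embed in S⁴ and whether their twists return S⁴ is his Q2.2; τ is ANY boundary diffeo (no involution/Stein), so one exotic generalised cork twist of S⁴ refutes it. Only C=B⁴ is settled (Cerf Γ₄=0).
sources: arXiv:1603.05090, Remark (d) p.8 and Question 2.2, Matveyev1996, Theorem (arXiv:dg-ga/9505001 p.2), CurtisFreedmanHsiangStong1996, Theorem, KirbyCorks1996, Theorem and Addendum, AkbulutYasui2008, Def. 2.1 (arXiv:0806.3010 p.5), Literature.Barriers.SmoothPoincare4.TwistedSphereBarrierFour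
New crux promised in THESIS-Stabilisation ('cork form of X — wait for IsCork/IsCorkTwist');
Literature.Topology.FourManifolds.IsCorkTwist is DONE (CorkTwist.lean:98, relational: S⁴ = C ∪_φ W
and X = C ∪_{φ∘τ} W via Literature.Topology.FourManifolds.IsBoundaryGluing). Statement: ∀ compact
contractible smooth C⁴ with boundary datum bC, ∀ τ : ∂C ≃ₘ ∂C, ∀ X (T2, 2nd countable, smooth 𝓡 4),
Literature.Topology.FourManifolds.IsCorkTwist bC τ (𝓡 4) S⁴ (𝓡 4) X → Nonempty (X ≃ₘ S⁴). EQUIVALENT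
to SPC4: (⇐) X is a homotopy 4-sphere (van Kampen: π₁(X) = π₁(W)/⟨⟨φτ(π₁∂C)⟩⟩ = π₁(W)/⟨⟨φ(π₁∂C)⟩⟩ =
π₁(S⁴) = 1 since τ_* is onto; Mayer–Vietoris with C acyclic); (⇒ SPC4) by the cork assembly item
(Literature.Topology.FourManifolds.corkDecomposition + Θ₄ h-cobordism fact wi-03818). Why file a
reformulation: it moves the problem onto PAIRS (C ↪ S⁴, τ) where cork technology applies — e.g. it
holds whenever τ extends to a diffeomorphism of the exterior W = S⁴ ∖ int C (true for all known cork
embeddings in S⁴: Akbulut2016 §10, AkbulutYasui2008 Thm 1.1 ff.; Gompf infinite-order corks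
arXiv:1603.05090), and refuter test families are concrete (Mazur corks W±(l,k), positron corks). No
IsCork hypothesis on (C, -/
@[route_item "route-SmoothPoincare4-Stabilisation"]
def StabCorkTwistSphere : Prop :=
  ∀ (C : Type) [TopologicalSpace C] [T2Space C] [SecondCountableTopology C] [ChartedSpace (EuclideanHalfSpace 4) C] [IsManifold (𝓡∂ 4) ∞ C] [CompactSpace C] [ContractibleSpace C] (bC : Literature.Topology.FourManifolds.BoundaryData (𝓡∂ 4) C (𝓡 3)) (τ : bC.carrier ≃ₘ⟮𝓡 3, 𝓡 3⟯ bC.carrier) (X : Type) [TopologicalSpace X] [T2Space X] [SecondCountableTopology X] [ChartedSpace (EuclideanSpace ℝ (Fin 4)) X] [IsManifold (𝓡 4) ∞ X], Literature.Topology.FourManifolds.IsCorkTwist bC τ (𝓡 4) (Metric.sphere (0 : EuclideanSpace ℝ (Fin 5)) 1) (𝓡 4) X → Nonempty (X ≃ₘ⟮𝓡 4, 𝓡 4⟯ Metric.sphere (0 : EuclideanSpace ℝ (Fin 5)) 1)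

/-- item stmt-SmoothPoincare4-0374 · support · rank 5 · closed · proved by Summit.SmoothPoincare4.SmoothPoincare4.Theorems.spc4ReductionHomotopySphere_proof (prover) · by planner
Shared reduction (bookkeeping, known): SmoothPoincare4 quantifies over bare (M, T2, 2nd-countable,
charted, smooth, e : M ≃ₕ S⁴); a manifold ≃ₕ S⁴ is compact (H₄ ≠ 0 forces compactness) and simply
connected hence smoothly orientable, so it packages as an
`Literature.Topology.FourManifolds.HomotopySphere 4`. Sources: KervaireMilnor1963 §1; Literature
HomotopySpheres.lean. opens: `open scoped Manifold ContDiff`, `open ContinuousMap`; imports: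
Summits.SmoothPoincare4.Statement +
Literature.Topology.FourManifolds.{HomotopySpheres,KirbyMoves,SliceRibbon,LeeRasmussen,Morse,ConnectedSum,Cobordism,GluckTwist,SurgeryGluck,CappellShaneson}
+ Literature.Geometry.Lorentzian.LeviCivita. -/
@[route_item "route-SmoothPoincare4-Stabilisation"]
def Spc4ReductionHomotopySphere : Prop :=
  (∀ S : Literature.Topology.FourManifolds.HomotopySphere 4, Nonempty (S.carrier ≃ₘ⟮𝓡 4, 𝓡 4⟯ Metric.sphere (0 : EuclideanSpace ℝ (Fin 5)) 1)) → SmoothPoincare4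

/-- `Spc4ReductionHomotopySphere` holds: proved by `Summit.SmoothPoincare4.SmoothPoincare4.Theorems.spc4ReductionHomotopySphere_proof`. -/
theorem Spc4ReductionHomotopySphere_holds : Spc4ReductionHomotopySphere := _root_.Summit.SmoothPoincare4.SmoothPoincare4.Theorems.spc4ReductionHomotopySphere_proof

/-- item stmt-SmoothPoincare4-0441 · support · rank 5 · open · by planner
SUPERSEDES stmt-SmoothPoincare4-0374 (grounder B/A2 + refuter A-0/A-1: TRUE bookkeeping but not
staffable as a bare implication). Now carries the two packaging facts as hypotheses: (hC) a smooth
4-manifold M ≃ₕ S⁴ is compact [Hatcher2002 Prop 3.29 + Thm 2.13; cite item filed]; (hO) such an M is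
orientable, `Literature.Topology.FourManifolds.IsOrientable (𝓡 4) M` [LeeSmoothManifolds2013 Thm
15.40 + Hatcher2002 Props 1.14/1.18; cite item filed]. Proof sketch (≈15 lines): intro hC hO h M _ _
_; unfold SmoothPoincare4 Literature.SPC4.SmoothPoincareConjectureFour
HomotopyEquiv.NonemptyDiffeomorphSphere; intro _ _ e; haveI := hC M e; obtain ⟨o⟩ := hO M e; exact h
⟨M, o, ⟨e⟩⟩ (mind the anonymous-constructor field order of
Literature.Topology.FourManifolds.HomotopySphere: carrier, [6 instances], orientation,
nonempty_homotopyEquiv; universe: carrier : Type = SmoothPoincareConjectureFour.{0} ✓). opens: `open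
scoped Manifold ContDiff`, `open ContinuousMap`; imports: Summits.SmoothPoincare4.Statement +
Literature.Topology.FourManifolds.HomotopySpheres + Literature.Geometry.Lorentzian.LeviCivita.
Elaborated 2026-08-13 session 3 with plain `lean check` (folder/Sk/Sketch3.lean rc 0). -/
@[route_item "route-SmoothPoincare4-Stabilisation"]
def Spc4ReductionHomotopySphereV2 : Prop :=
  (∀ (M : Type) [TopologicalSpace M] [T2Space M] [SecondCountableTopology M] [ChartedSpace (EuclideanSpace ℝ (Fin 4)) M] [IsManifold (𝓡 4) ∞ M], M ≃ₕ Metric.sphere (0 : EuclideanSpace ℝ (Fin 5)) 1 → CompactSpace M) → (∀ (M : Type) [TopologicalSpace M] [T2Space M] [SecondCountableTopology M] [ChartedSpace (EuclideanSpace ℝ (Fin 4)) M] [IsManifold (𝓡 4) ∞ M], M ≃ₕ Metric.sphere (0 : EuclideanSpace ℝ (Fin 5)) 1 → Literature.Topology.FourManifolds.IsOrientable (𝓡 4) M) → (∀ S : Literature.Topology.FourManifolds.HomotopySphere 4, Nonempty (S.carrier ≃ₘ⟮𝓡 4, 𝓡 4⟯ Metric.sphere (0 : EuclideanSpace ℝ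 (Fin 5)) 1)) → SmoothPoincare4

/-- item stmt-SmoothPoincare4-0398 · assembly · rank 1 · open · by planner
Immediate from S1, S2 and the shared reduction item stmt-SmoothPoincare4-0374. -/
@[route_item "route-SmoothPoincare4-Stabilisation"]
def Assembly : Prop :=
  ((∀ S : Literature.Topology.FourManifolds.HomotopySphere 4, ∃ (P : Type) (_ : TopologicalSpace P) (_ : ChartedSpace (EuclideanSpace ℝ (Fin 4)) P) (_ : IsManifold (𝓡 4) ∞ P), Literature.Topology.FourManifolds.IsConnectedSum (𝓡 4) (𝓡 4) ((𝓡 2).prod (𝓡 2)) S.carrier ((Metric.sphere (0 : EuclideanSpace ℝ (Fin 3)) 1) × (Metric.sphere (0 : EuclideanSpace ℝ (Fin 3)) 1)) P ∧ Nonempty (P ≃ₘ⟮𝓡 4, (𝓡 2).prod (𝓡 2)⟯ ((Metric.sphere (0 : EuclideanSpace ℝ (Fin 3)) 1) × (Metric.sphere (0 : EuclideanSpace ℝ (Fin 3)) 1)))) ∧ (∀ S : Literature.Topology.FourManifolds.HomotopySphere 4, (∃ (P : Type) (_ : TopologicalSpace P) (_ : ChartedSpace (EuclideanSpace ℝ (Fin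 4)) P) (_ : IsManifold (𝓡 4) ∞ P), Literature.Topology.FourManifolds.IsConnectedSum (𝓡 4) (𝓡 4) ((𝓡 2).prod (𝓡 2)) S.carrier ((Metric.sphere (0 : EuclideanSpace ℝ (Fin 3)) 1) × (Metric.sphere (0 : EuclideanSpace ℝ (Fin 3)) 1)) P ∧ Nonempty (P ≃ₘ⟮𝓡 4, (𝓡 2).prod (𝓡 2)⟯ ((Metric.sphere (0 : EuclideanSpace ℝ (Fin 3)) 1) × (Metric.sphere (0 : EuclideanSpace ℝ (Fin 3)) 1)))) → Nonempty (S.carrier ≃ₘ⟮𝓡 4, 𝓡 4⟯ Metric.sphere (0 : EuclideanSpace ℝ (Fin 5)) 1))) → SmoothPoincare4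

-- records of items no longer active in this route (dropped / restated):
-- earlier Assembly2 (stmt-SmoothPoincare4-0449, dropped 2026-08-16T14:43:06Z): proved by Literature.SPC4.stab_assembly — (∀ (M : Type) [TopologicalSpace M] [T2Space M] [SecondCountableTopology M] [ChartedSpace (EuclideanSpace ℝ (Fin 4)) M] [IsManifold (𝓡 4) ∞ M], M ≃ₕ Metric.sphere (0 : EuclideanSpace ℝ (Fin 5)) 1 → CompactSpace M) → (∀ (M : Type) [TopologicalSpace M] [T2Space M] [SecondCountableTop
-- earlier Assembly3 (stmt-SmoothPoincare4-0479, dropped 2026-08-16T14:43:06Z): proved by Literature.SPC4.stab_cork_assembly — Literature.Topology.FourManifolds.corkDecomposition.{0} → (∀ S : Literature.Topology.FourManifolds.HomotopySphere 4, Literature.Topology.FourManifolds.IsHCobordant 4 S.carrier (Metric.sphere (0 : EuclideanSpace ℝ (Fin 5)) 1)) → (∀ (M : Type) [TopologicalSpace M], M ≃ₕ Metric.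

/-! D-0027 §2.1 — DECIDING THEOREM (planner-authored via `route open/edit --closes-file`; by planner-rbadge-SmoothPoincare4-Stabilisation-f42c03a6-g4-0 2026-08-15T16:19:35Z):
its hypotheses are this route's items and its conclusion the sub-problem Statement (glue_lint), and it elaborates with this file. -/

@[closes "route-SmoothPoincare4-Stabilisation"] theorem closes (h₂ : StabCancellation) (h₃ : StabOneSuffices) : _root_.SmoothPoincare4 := by
  intro M _ _ _ _ _ e
  haveI : CompactSpace M :=
    Literature.Topology.FourManifolds.compactSpace_of_homotopyEquiv_sphere_four_holds M e
  let S : Literature.Topology.FourManifolds.HomotopySphere 4 :=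
    { carrier := M
      orientation := Classical.choice
        (Literature.Topology.FourManifolds.isOrientable_of_homotopyEquiv_sphere_four_holds M e)
      nonempty_homotopyEquiv := ⟨e⟩ }
  exact h₂ S (h₃ S)

end Summit.SmoothPoincare4.SmoothPoincare4.Theses.Stabilisation
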